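import Literature.AlgebraicGeometry.Markman2025.SecantQuotientCarrier
import HarnessLib
import Literature.AlgebraicGeometry.Motives.FourTranslatesMeet

/-!
# `SheafSeedGaussSq` (stmt-HodgeConjecture-30548), line `secant-q824`: the input datum `GenusFourSecantDatum` is
# UNINHABITED — its field `generalPosition` (any FOUR translates of `Θ` disjoint) contradicts `dim J = 4`

Negative lemmas of the standing disprover (`cdisprove-stmt-HodgeConjecture-30548`) for the plan-only rung
`stub_rung_secantObjectsQ824 : ∀ C, ∃ D : GenusFourSecantDatum, D.j = 1 ∧ D.HasSecantObjects C AdmTw'` of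
`Cruxes/SheafSeedGaussSq/Lines/secant_q824.lean` (v3). The structure `GenusFourSecantDatum` there is, verbatim, the
genus-3 `SecantQuotientDatum` of `Theorems/VHCAbelianSchemesRoadSecantQuotientAnchorDefs.lean` with `dim_J : 𝒥.J.dim = 3`
replaced by `𝒥.J.dim = 4` — but its last field was NOT re-dimensioned:

  `generalPosition : TranslatesInGeneralPosition 𝒥.J Θ (sumSet G₁ G₂)`

(`Literature/AlgebraicGeometry/Markman2025/SecantQuotientCarrier`): ANY FOUR translates `τ_s(Supp Θ)`, `s ∈ G₁G₂` pairwise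
distinct, have EMPTY intersection (and any three meet in a finite set). That is Markman's Assumption 9.2.1 (1) / proof of
Lemma 9.3.1 for an abelian THREEFOLD (`n = 3`: four surfaces in a threefold are generically disjoint). On an abelian
FOURFOLD four translates of the ample effective divisor `Θ` always meet: `(Θ⁴) = 4! = 24 > 0`, more elementarily an ample
effective divisor meets every positive-dimensional closed subvariety, so `τ_{s₁}Θ ∩ τ_{s₂}Θ ∩ τ_{s₃}Θ ∩ τ_{s₄}Θ` has all
components of dimension `≥ 0` and is non-empty (Lange–Birkenhake, Complex Abelian Varieties, Thm. 3.6.3 Riemann–Roch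
`(Lᵍ) = g!·χ(L)` and §4.1; Fulton, Intersection Theory, Ex. 12.1.10 / Lemma 12.1 for meeting of ample divisors).

What is proved here, sorry-free, over the tree's REAL carriers (no route item, no stub, nothing of the preprint is
asserted; nothing here says anything about HC / HC_AV / HC_CM / WeilSixfolds / stmt-18881 / stmt-30548 themselves):

* `exists_four_translates_inter_eq_empty` — UNCONDITIONAL: general position of the translates indexed by `sumSet G₁ G₂`
  with `G₁, G₂ ≠ ⊥`, `G₁ ⊓ G₂ = ⊥` produces `a ∈ G₁`, `b ∈ G₂` with `τ_1Θ ∩ τ_aΘ ∩ τ_bΘ ∩ τ_{ab}Θ = ∅`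
  (the four indices `1, a, b, ab` are pairwise distinct members of `G₁G₂`);
* `ne_bot_of_card_eq_sq_succ` — `Nat.card G = j² + 1`, `0 < j` ⟹ `G ≠ ⊥` (the datum's `card₁`, `card₂`, `j_pos`);
* `FourTranslatesMeet` — the precise hypothesis `H` (a `Prop` with a body, NOT proved here: intersection numbers /
  "ample meets every curve" are not in the tree): on an abelian variety of dimension `4` over `ℂ`, any four translates of
  the support of an effective ample Cartier divisor have a common point;
* `not_translatesInGeneralPosition_of_fourTranslatesMeet` — modulo `H`: with `A.dim = 4`, `Θ` effective and ample,
  `G₁, G₂ ≠ ⊥`, `G₁ ⊓ G₂ = ⊥`, the predicate `TranslatesInGeneralPosition A Θ (sumSet G₁ G₂)` is FALSE;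
* `genusFourSecantDatum_fields_false_of_fourTranslatesMeet` — modulo `H`, the conjunction of the fields `dim_J`,
  `riemann`, `principal`, `j_pos`, `card₁`, `card₂`, `disjoint`, `generalPosition` of `GenusFourSecantDatum` (quantified
  over exactly the structure's data: a curve `C`, a Jacobian `𝒥`, `Θ`, `j`, `G₁`, `G₂`) is contradictory. Hence, modulo
  `H`, `GenusFourSecantDatum` is empty, `stub_rung_secantObjectsQ824` (`∀ C, ∃ D, …`) is false as soon as one
  `C : ChernCharacterBetti` exists, the line's `GenusFourSecantSeed` likewise, and `stub_transfer_secantQuotientEightfold`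
  (`∀ C D, …`) is vacuously true — the line `secant-q824` proves nothing as typed (stub-MISSTATED, not the crux refuted).

REPAIR (for the line's writer, not done here): the dimension-4 analogue of Lemma 9.3.1's condition is «any FIVE pairwise
distinct translates have empty intersection and any FOUR meet in a finite set»; at `j = 1` (`#G₁G₂ = 4`) only the
finiteness clause for the four translates `τ_0Θ, τ_{g₁}Θ, τ_{g₂}Θ, τ_{g₁+g₂}Θ` remains.

Refuter `refuter-cdisprove-stmt-HodgeConjecture-30548-g0-0`, 2026-08-30. References:
[cite: Markman2025SecantWeil, §9.2 Assumption 9.2.1 (1) and §9.3 Lemma 9.3.1 (proof), arXiv:2502.03415 pp. 60, 70]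
[cite: Lange2023AbelianVarietiesComplex, §1.7 Thm. 1.7.3 (Riemann–Roch (L^g) = g!·χ(L)) and §2.1]
-/

noncomputable section

open CategoryTheory AlgebraicGeometry
open Literature.AlgebraicGeometry Literature.AlgebraicGeometry.Motives Literature.AlgebraicGeometry.Motives.AbelianVariety
open Literature.AlgebraicGeometry.Markman2025

namespace Summit.HodgeConjecture.HodgeConjecture.Theorems.SheafSeedGaussSq.Negative

-- the cell's namespace repeats the summit name, as in every summit-side file of this single-problem summit
set_option linter.dupNamespace false

/-! ## §1 Unconditional: general position of the `G₁G₂`-translates forces four DISJOINT translates -/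

section General

variable {A : AbelianVariety ℂ} {Θ : CartierDivisor A.X.left} {G₁ G₂ : Subgroup (A.Points ℂ)}

/-- `g₁ g₂ ∈ G₁G₂` for `g₁ ∈ G₁`, `g₂ ∈ G₂`. [folklore] -/
theorem mul_mem_sumSet {g₁ g₂ : A.Points ℂ} (h₁ : g₁ ∈ G₁) (h₂ : g₂ ∈ G₂) : g₁ * g₂ ∈ sumSet G₁ G₂ :=
  ⟨g₁, h₁, g₂, h₂, rfl⟩

/-- `1 ∈ G₁G₂`. [folklore] -/
theorem one_mem_sumSet : (1 : A.Points ℂ) ∈ sumSet G₁ G₂ := by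
  simpa using mul_mem_sumSet (G₁ := G₁) (G₂ := G₂) G₁.one_mem G₂.one_mem

/-- `G₁ ⊆ G₁G₂`. [folklore] -/
theorem mem_sumSet_of_mem_left {g : A.Points ℂ} (h : g ∈ G₁) : g ∈ sumSet G₁ G₂ := by
  simpa using mul_mem_sumSet (G₁ := G₁) (G₂ := G₂) h G₂.one_mem

/-- `G₂ ⊆ G₁G₂`. [folklore] -/
theorem mem_sumSet_of_mem_right {g : A.Points ℂ} (h : g ∈ G₂) : g ∈ sumSet G₁ G₂ := by
  simpa using mul_mem_sumSet (G₁ := G₁) (G₂ := G₂) G₁.one_mem h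

/-- An element of both `G₁` and `G₂` is trivial when `G₁ ⊓ G₂ = ⊥`. [folklore] -/
theorem eq_one_of_mem_of_mem (hd : G₁ ⊓ G₂ = ⊥) {g : A.Points ℂ} (h₁ : g ∈ G₁) (h₂ : g ∈ G₂) : g = 1 :=
  (Subgroup.eq_bot_iff_forall _).mp hd g (Subgroup.mem_inf.mpr ⟨h₁, h₂⟩)

/-- **General position of the `G₁G₂`-indexed translates yields four DISJOINT translates.** If the translates
`τ_s(Supp Θ)`, `s ∈ G₁G₂`, are in general position in the sense of `TranslatesInGeneralPosition` (any four with pairwise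
distinct indices have empty intersection) and `G₁, G₂` are non-trivial with `G₁ ⊓ G₂ = ⊥`, then for some `a ∈ G₁`,
`b ∈ G₂` the four translates by `1, a, b, ab` — pairwise distinct elements of `G₁G₂` — have empty intersection.
Unconditional; pure group theory plus the first clause of the predicate. [folklore] -/
theorem exists_four_translates_inter_eq_empty (hgp : TranslatesInGeneralPosition A Θ (sumSet G₁ G₂))
    (h₁ : G₁ ≠ ⊥) (h₂ : G₂ ≠ ⊥) (hd : G₁ ⊓ G₂ = ⊥) :
    ∃ a ∈ G₁, ∃ b ∈ G₂, a ≠ 1 ∧ b ≠ 1 ∧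
      thetaTranslate A Θ 1 ∩ thetaTranslate A Θ a ∩ thetaTranslate A Θ b ∩ thetaTranslate A Θ (a * b) = ∅ := by
  obtain ⟨⟨a, ha⟩, ha1⟩ := Subgroup.ne_bot_iff_exists_ne_one.mp h₁
  obtain ⟨⟨b, hb⟩, hb1⟩ := Subgroup.ne_bot_iff_exists_ne_one.mp h₂
  have ha1 : a ≠ 1 := fun h => ha1 (Subtype.ext h)
  have hb1 : b ≠ 1 := fun h => hb1 (Subtype.ext h)
  refine ⟨a, ha, b, hb, ha1, hb1, hgp.1 1 one_mem_sumSet a (mem_sumSet_of_mem_left ha) b (mem_sumSet_of_mem_right hb)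
    (a * b) (mul_mem_sumSet ha hb) (fun h => ha1 h.symm) (fun h => hb1 h.symm) ?_ ?_ ?_ ?_⟩
  · -- `1 ≠ a * b`: otherwise `b = a⁻¹ ∈ G₁ ⊓ G₂ = ⊥`
    intro h
    have hb' : b ∈ G₁ := by
      rw [← inv_eq_of_mul_eq_one_right h.symm]
      exact G₁.inv_mem ha
    exact hb1 (eq_one_of_mem_of_mem hd hb' hb)
  · -- `a ≠ b`: otherwise `a ∈ G₁ ⊓ G₂ = ⊥`
    intro h
    exact ha1 (eq_one_of_mem_of_mem hd ha (h ▸ hb))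
  · -- `a ≠ a * b`: otherwise `b = 1`
    intro h
    exact hb1 (mul_left_cancel (a := a) (by rw [mul_one]; exact h)).symm
  · -- `b ≠ a * b`: otherwise `a = 1`
    intro h
    exact ha1 (mul_right_cancel (b := b) (by rw [one_mul]; exact h)).symm

/-- `#G = j² + 1` with `j ≥ 1` makes `G` non-trivial (the datum's fields `card₁`/`card₂`, `j_pos`). [folklore] -/
theorem ne_bot_of_card_eq_sq_succ {G : Subgroup (A.Points ℂ)} {j : ℕ} (hj : 0 < j) (hc : Nat.card G = j ^ 2 + 1) :
    G ≠ ⊥ := by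
  rintro rfl
  rw [Subgroup.card_bot] at hc
  have : 0 < j ^ 2 := pow_pos hj 2
  omega

end General

/-! ## §2 The hypothesis `H`: four translates of an ample effective divisor on an abelian fourfold meet -/

/-- **Modulo `H`, general position of the `G₁G₂`-translates is impossible on an abelian fourfold** (for `Θ` effective
and ample, `G₁, G₂ ≠ ⊥`, `G₁ ⊓ G₂ = ⊥`). [folklore] -/
theorem not_translatesInGeneralPosition_of_fourTranslatesMeet (H : Literature.AlgebraicGeometry.Motives.FourTranslatesMeet) {A : AbelianVariety ℂ}
    {Θ : CartierDivisor A.X.left} (hdim : A.dim = 4) (hE : Θ.IsEffective) (hA : Θ.IsAmple)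
    {G₁ G₂ : Subgroup (A.Points ℂ)} (h₁ : G₁ ≠ ⊥) (h₂ : G₂ ≠ ⊥) (hd : G₁ ⊓ G₂ = ⊥) :
    ¬ TranslatesInGeneralPosition A Θ (sumSet G₁ G₂) := by
  intro hgp
  obtain ⟨a, -, b, -, -, -, he⟩ := exists_four_translates_inter_eq_empty hgp h₁ h₂ hd
  exact (H A Θ hdim hE hA 1 a b (a * b)).ne_empty he

/-- **Modulo `H`, the fields of `GenusFourSecantDatum` (line `secant-q824`, v3) are jointly unsatisfiable**: over exactly
the structure's data — a complex curve `C`, a Jacobian `𝒥` of `C` with `dim J = 4`, a Riemann theta divisor `Θ` that is a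
principal polarization divisor, `j ≥ 1`, subgroups `G₁, G₂ ≤ J(ℂ)` of order `j² + 1` with `G₁ ⊓ G₂ = ⊥` — the field
`generalPosition : TranslatesInGeneralPosition 𝒥.J Θ (sumSet G₁ G₂)` cannot hold. (The fields `smooth`, `endQ`,
`G₁_le`, `G₂_le`, `cyclic₁`, `cyclic₂` are not even needed.) So, modulo `H`, the datum type is empty, STUB 1
`stub_rung_secantObjectsQ824` is false for every `C : ChernCharacterBetti`, and STUB 2 is vacuous. [folklore] -/
theorem genusFourSecantDatum_fields_false_of_fourTranslatesMeet (H : Literature.AlgebraicGeometry.Motives.FourTranslatesMeet) {C : SchemeOver ℂ}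
    (𝒥 : Jacobian C) (hdim : 𝒥.J.dim = 4) {Θ : CartierDivisor 𝒥.J.X.left} (hR : 𝒥.IsRiemannThetaDivisor Θ)
    (hP : 𝒥.J.IsPrincipalPolarizationDivisor Θ) {j : ℕ} (hj : 0 < j) {G₁ G₂ : Subgroup (𝒥.J.Points ℂ)}
    (hc₁ : Nat.card G₁ = j ^ 2 + 1) (hc₂ : Nat.card G₂ = j ^ 2 + 1) (hd : G₁ ⊓ G₂ = ⊥) :
    ¬ TranslatesInGeneralPosition 𝒥.J Θ (sumSet G₁ G₂) :=
  not_translatesInGeneralPosition_of_fourTranslatesMeet H hdim hR.isEffective hP.isAmple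
    (ne_bot_of_card_eq_sq_succ hj hc₁) (ne_bot_of_card_eq_sq_succ hj hc₂) hd

/-- The same at the rung's level `j = 1` (`#G₁ = #G₂ = 2`, level `q⁸ = 2⁴`): the four translates
`τ_0Θ, τ_{g₁}Θ, τ_{g₂}Θ, τ_{g₁+g₂}Θ` are ALL the translates, and `generalPosition` asks them to be disjoint. [folklore] -/
theorem genusFourSecantDatum_fields_false_levelOne_of_fourTranslatesMeet (H : Literature.AlgebraicGeometry.Motives.FourTranslatesMeet) {C : SchemeOver ℂ}
    (𝒥 : Jacobian C) (hdim : 𝒥.J.dim = 4) {Θ : CartierDivisor 𝒥.J.X.left} (hR : 𝒥.IsRiemannThetaDivisor Θ)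
    (hP : 𝒥.J.IsPrincipalPolarizationDivisor Θ) {G₁ G₂ : Subgroup (𝒥.J.Points ℂ)}
    (hc₁ : Nat.card G₁ = 2) (hc₂ : Nat.card G₂ = 2) (hd : G₁ ⊓ G₂ = ⊥) :
    ¬ TranslatesInGeneralPosition 𝒥.J Θ (sumSet G₁ G₂) :=
  genusFourSecantDatum_fields_false_of_fourTranslatesMeet H 𝒥 hdim hR hP (j := 1) one_pos hc₁ hc₂ hd

end Summit.HodgeConjecture.HodgeConjecture.Theorems.SheafSeedGaussSq.Negative

end
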